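import Mathlib
import HarnessLib
import Summits.NavierStokesRegularity.NavierStokesRegularity.Theses.LocalRuledPressureDoor
import Summits.NavierStokesRegularity.NavierStokesRegularity.Theorems.LocalPressureProfileDoorLocalPointZoomSimilarityPressure

/-!
# `LocalRuledPressureDoor.LocalPointZoomSimilarityPressure` (item stmt-NavierStokesRegularity-28000) — BY NAME

The statement is VERBATIM the proved crux `LocalPressureProfileDoor.LocalPointZoomSimilarityPressure` (stmt-20181, proved by
`Summit.NavierStokesRegularity.NavierStokesRegularity.Theorems.LocalPressureProfileDoorLocalPointZoomSimilarityPressure.LocalPointZoomSimilarityPressure_proof`):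
the local point zoom at a locally Type-I, not backward bounded point with pointwise convergence of the velocities AND of the
similarity Riesz pressures on every slice.  Cited by name.

HONEST FRAMING: a proved compactness/bookkeeping statement about HYPOTHETICAL Type-I blow-ups, re-filed for a new DRAFT door route;
nothing here bears on Navier–Stokes regularity.
-/

noncomputable section

set_option linter.dupNamespace false

namespace Summit.NavierStokesRegularity.NavierStokesRegularity.Theorems

/-- **Item stmt-NavierStokesRegularity-28000** (`LocalRuledPressureDoor.LocalPointZoomSimilarityPressure`) — verbatim the PROVED
crux 20181 of route `LocalPressureProfileDoor`, cited by name. [cite: SereginSverak2009, §3; KochNadirashviliSereginSverak2009, §5–6] -/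
theorem localRuledPressureDoor_localPointZoomSimilarityPressure_proof :
    Summit.NavierStokesRegularity.NavierStokesRegularity.Theses.LocalRuledPressureDoor.LocalPointZoomSimilarityPressure :=
  LocalPressureProfileDoorLocalPointZoomSimilarityPressure.LocalPointZoomSimilarityPressure_proof

end Summit.NavierStokesRegularity.NavierStokesRegularity.Theorems

end
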